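import Summits.HodgeConjecture.HodgeConjecture.Theorems.K2E3LocalUnitaryWittRefinement   -- ★ `wittBlockOn_mono_of_subset` (`hmono`) (+ D₁ parts 1∕2, 2∕2: `standardParabolicTriple`, anti-block)
import Summits.HodgeConjecture.HodgeConjecture.Theorems.K2E3ParabolicCoarsening          -- ★ K2E3-p10: `le_normalizer_leviTriple`, `isComplement'_leviTriple`, `exists_nest`
import HarnessLib

/-!
# K2 ∕ E3 «EllipticInputs», 13a road A — DEFS LEAF D₁ (supplement 3) `K2E3LocalUnitaryWittLeviTriple`: the LEVI TRIPLES
# `leviTriple σ e Han hS : ParabolicTriple ↥(M_{S′})` (`S ⊆ S′`) of the unitary group of a Witt normal form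

Cell `hodgecm-mathlib` (Track B «K2-LIT»), item h413 = `stmt-HodgeConjecture-24833`, line `K2_E3_EllipticInputs`, socket U12-g ∕ 13a road A; author K2-defs1 (g2)
(cut (a) of K2E3-p10 (g2), K2/STATUS 2026-09-03T23:37:51Z); count-neutral; `--supports … --as helper`; namespace of ★ `K2E3LocalUnitaryWittDefs`.  No `sorry`, no
named fact, no `instance`, no `notation`.  ASSEMBLY ONLY: the theorem content (Levi decomposition of `P_S ∩ M_{S′}` inside `M_{S′}`) is ★ K2E3-p10's
`K2E3ParabolicCoarsening.le_normalizer_leviTriple` ∕ `isComplement'_leviTriple`, fed with the coarsening hypothesis ★ `wittBlockOn_mono_of_subset` (`hmono`), the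
mirror `τ = Fin.rev` and the anti-block lemma ★ `wittBlockOn_eq_rev_of_wittFormOn_ne_zero`.

CONTENT.  For `σ : R →+* R`, a Witt frame `e : WittIndex r m ≃ n`, an anisotropic kernel `Han` and `S ⊆ S′ ⊆ Fin r` (simple roots in the Levis, `P_S ≤ P_{S′}`):
**`leviTriple σ e Han hS : ParabolicTriple ↥(wittLevi σ (wittFormOn e Han) e S′)`** with `P = P_S ∩ M_{S′}`, `M = M_S`, `N = N_S ∩ M_{S′}` (as `subgroupOf` the Levi
`M_{S′}`; `rfl` lemmas `leviTriple_P ∕ _M ∕ _N`) — the `s i j` of the DRIVER ★ `K2E3LocalIrrepAdmissibleOfConeInputs` for the index preorder «`S_j ⊆ S_i`»,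
next to `t i = standardParabolicTriple σ e Han S_i` (★ `K2E3LocalUnitaryWittParabolicDefs`).

HONEST LABEL: HC_CM is proved only modulo the 7 printed citations (2 remaining named inputs: hLiu418 = stmt-HodgeConjecture-24832, h413 =
stmt-HodgeConjecture-24833) until rung 0 closes; this file is count-neutral.

## References
* [BernsteinZelevinsky1977] I. N. Bernstein, A. V. Zelevinsky, Ann. Sci. ÉNS 10 (1977), §2.1–§2.3 (nested standard parabolics, `P_β ∩ M_γ = M_β ⋉ (U_β ∩ M_γ)`).
* [Borel1991] A. Borel, *Linear Algebraic Groups*, 2nd ed. (1991), §23 (standard parabolics `P_I ⊆ P_{I′}` and their Levi subgroups).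
-/

set_option autoImplicit false
-- the mandated namespace repeats `HodgeConjecture.HodgeConjecture`, as in every `Theorems/*.lean` of this sub-problem
set_option linter.dupNamespace false

namespace Summit.HodgeConjecture.HodgeConjecture.Cruxes.H413.K2E3LocalUnitaryWitt

open Literature.NumberTheory.Automorphic

section LeviTriple

variable {R : Type*} [CommRing R] (σ : R →+* R) {n : Type*} [Fintype n] [DecidableEq n] {r m : ℕ}
  (e : WittIndex r m ≃ n) (Han : Matrix (Fin m) (Fin m) R) {S S' : Finset (Fin r)}

/-- **The Levi triple `(P_S ∩ M_{S′}, M_S, N_S ∩ M_{S′})` of the Levi subgroup `M_{S′}` of `U(σ, W(r, Han))`**, for `S ⊆ S′`, as the tree's ★ `ParabolicTriple`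
of `↥(wittLevi σ (wittFormOn e Han) e S′)`: the standard parabolic of the reductive group `M_{S′} ≅ ∏ GL(blocks) × U(middle block)` determined by the finer
labelling `wittBlock S`.  Proof fields: ★ `K2E3ParabolicCoarsening.le_normalizer_leviTriple` and ★ `isComplement'_leviTriple` (K2E3-p10), with
`hmono := wittBlockOn_mono_of_subset e hS`, `τ := Fin.rev`, `hJ := wittBlockOn_eq_rev_of_wittFormOn_ne_zero e S Han`.
[cite: BernsteinZelevinsky1977, §2.1–§2.3] [cite: Borel1991, §23] -/
noncomputable def leviTriple (hS : S ⊆ S') : ParabolicTriple ↥(wittLevi σ (wittFormOn e Han) e S') where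
  P := (wittParabolic σ (wittFormOn e Han) e S).subgroupOf (wittLevi σ (wittFormOn e Han) e S')
  M := (wittLevi σ (wittFormOn e Han) e S).subgroupOf (wittLevi σ (wittFormOn e Han) e S')
  N := (wittRadical σ (wittFormOn e Han) e S).subgroupOf (wittLevi σ (wittFormOn e Han) e S')
  M_le := Subgroup.comap_mono (wittLevi_le_wittParabolic σ (wittFormOn e Han) e S)
  N_le := Subgroup.comap_mono (wittRadical_le_wittParabolic σ (wittFormOn e Han) e S)
  le_normalizer :=
    K2E3ParabolicCoarsening.le_normalizer_leviTriple σ (c := wittBlockOn e S) (c' := wittBlockOn e S') (J := wittFormOn e Han)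
  isComplement' :=
    K2E3ParabolicCoarsening.isComplement'_leviTriple σ (c := wittBlockOn e S) (c' := wittBlockOn e S')
      (hmono := wittBlockOn_mono_of_subset e hS) (J := wittFormOn e Han) (τ := Fin.rev)
      (hτ := fun _ _ h => Fin.rev_le_rev.2 h) (hτi := Fin.rev_injective)
      (hJ := wittBlockOn_eq_rev_of_wittFormOn_ne_zero e S Han)

/-- The parabolic of `leviTriple` is `P_S ∩ M_{S′}` (`rfl`). [cite: BernsteinZelevinsky1977, §2.1–§2.3] -/
@[simp] theorem leviTriple_P (hS : S ⊆ S') :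
    (leviTriple σ e Han hS).P = (wittParabolic σ (wittFormOn e Han) e S).subgroupOf (wittLevi σ (wittFormOn e Han) e S') := rfl

/-- The Levi of `leviTriple` is `M_S` (read inside `M_{S′}`; `rfl`). [cite: BernsteinZelevinsky1977, §2.1–§2.3] -/
@[simp] theorem leviTriple_M (hS : S ⊆ S') :
    (leviTriple σ e Han hS).M = (wittLevi σ (wittFormOn e Han) e S).subgroupOf (wittLevi σ (wittFormOn e Han) e S') := rfl

/-- The radical of `leviTriple` is `N_S ∩ M_{S′}` (`rfl`). [cite: BernsteinZelevinsky1977, §2.1–§2.3] -/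
@[simp] theorem leviTriple_N (hS : S ⊆ S') :
    (leviTriple σ e Han hS).N = (wittRadical σ (wittFormOn e Han) e S).subgroupOf (wittLevi σ (wittFormOn e Han) e S') := rfl

/-- The Levi triple sits inside the Levi of the standard triple: its ambient group IS `(standardParabolicTriple σ e Han S′).M` (`rfl` on the carrier subgroup).
[cite: Borel1991, §23] -/
theorem standardParabolicTriple_M_eq (S' : Finset (Fin r)) : (standardParabolicTriple σ e Han S').M = wittLevi σ (wittFormOn e Han) e S' := rfl

end LeviTriple

end Summit.HodgeConjecture.HodgeConjecture.Cruxes.H413.K2E3LocalUnitaryWitt
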